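/-
Copyright (c) 2026 the pub-hodgecm-mathlib formalisation cell (harness21).  Prover seat hodgecm-mathlib-LH4-p06 (g7), req620 Track A «(D-RAM) FOUR-FRAME» squad, helper lane
on h413 = stmt-HodgeConjecture-24833 (count-neutral).  THE (LAW) END OF RECORD for the level pieces, modulo the RamM lane (dealer LH4-plan (g13) WORD #96 (1)).  2026-09-04.
-/
import Summits.HodgeConjecture.HodgeConjecture.Theorems.F0P3cDyRamLevelsCensusTypeSplit            -- ★ p860426 (this seat) A: `levelsCensus2_of_types (hA) (hB) (hC)`
import Summits.HodgeConjecture.HodgeConjecture.Theorems.F0P3cDyRamLevelsCensusLineModels           -- ★ p860451 (this seat) B: `levelsCensus4_of_levelsCensus2`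
import Summits.HodgeConjecture.HodgeConjecture.Theorems.F0P3cDyRamLevelsTypeTwoCensusLawOfSockets  -- ★ p860470 (this seat) C: `levels_typeTwo_censusLaw_of_levelsCensus4`
import Summits.HodgeConjecture.HodgeConjecture.Theorems.F0P3cDyRamLevelsCensusUnr                  -- ★ p860533 (LH4-p08 (g9)) THE U LANE `levelsCensusA`, BY NAME
import Summits.HodgeConjecture.HodgeConjecture.Theorems.F0P3cDyRamLevelsCensusRamK                 -- ★ (LH4-p07 (g9)) THE RamK LANE `levelsCensusB`, BY NAME
import HarnessLib

/-!
# Crux `H413`, line LH4 «(D-RAM) FOUR-FRAME» — THE TYPE-(2) CENSUS LAW OF THE LEVEL PIECE `𝟙_{K_{a,b}}` IN ★ p859606's CURRENCY, OF RECORD (modulo the RamM lane only)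

Cell `hodgecm-mathlib` (D-0151), FLOOR 0, crux item H413 = `stmt-HodgeConjecture-24833`, route `HCCMUnconditional`; squad F0∕P3c∕LH4.  THEOREMS ONLY (one theorem; no `def`,
no instance, no notation, no `sorry`); ★ imports only; lane `--supports stmt-HodgeConjecture-24833 --as helper`.  COUNT-NEUTRAL: the RamM lane (`hC`: `levelsCensusC`, staffed by dealer
WORD #97∕#98) is a HYPOTHESIS (its ∃V body at this place and piece); the U lane is ★ `levelsCensusA` (LH4-p08 (g9), p860533) and the RamK lane ★ `levelsCensusB` (LH4-p07 (g9)) BY NAME.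

WHAT (dealer LH4-plan (g13) WORD #96 (1)).  **`levels_typeTwo_censusLaw (L w hw he ϖ hϖ d tE hD h2v) [Fintype k_w] [MeasurableSpace G₃] (νG₃) (a b ks bs : ℕ) (had : a ≤ d) (hab1 : d + 2a ≤ b + 1)
(hks : 2ks + 2((d + a%2)∕2) = a + a%2 + (b + b%2)) (hbs0 : a % 2 = 0 → bs + a = ks) (hbs1 : a % 2 = 1 → bs + a + 1 = ks + 2(d % 2))
(hC : ‹RamM-lane ∃V body at (a, b, ks, T := d − d%2 + bs)›) : ‹★ p859606's hLaw at (a, b), cA := νG₃(K)·2·q^{−ks}, cB := νG₃(K)·4·(q^{−ks} − q^{shiftR d t_E − ks + bs})∕(q − 1)›`**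
:= ★ C ∘ ★ B ∘ ★ A `(levelsCensusA …) (levelsCensusB …) hC`
at `T := d − d%2 + bs` (`hTbs := rfl`; the lanes' `hT0 ∕ hT1` from `hbs0 ∕ hbs1` by `omega`).  The `hC` body is LH4-p07's SIG fc50d796∕8a298c40 text with the RamM descent letter
`|α − ρα| < 1` (★ A's `hC` binder token for token) and `T` instantiated; the day `levelsCensusC` is ★ the hypothesis-free END is ONE line in this file's context:
`levels_typeTwo_censusLaw' … := levels_typeTwo_censusLaw … (levelsCensusC L w hw he ϖ hϖ d tE hD h2v a b ks _ had hab1 hks ‹hT0› ‹hT1›)`.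
The five H-side CONSUMERS (tier-0 `stub_hside_levLo∕levHi∕sq` sentences and LH4-p14's two T₊ inputs) are `F0P3cDyRamHSideStubsOfLevelsCensusLaw` (this seat), modulo this END's closure.
SCOPE NOTE.  This file keeps ★ A∕C's `open` context (`Valued` scoped): the lane texts contain `𝒪[L_w] ⧸ 𝓂[L_w]^{2b}` tokens and MUST be elaborated as in ★ A (a first attempt under the
H-side files' `ValuativeRel` scope produced a different term); ★ p859606's letter itself is scope-robust (probe 665f0577).
HONEST LABEL.  Count-neutral (`--supports`); pays no registered stub; `HC_CM` is proved only modulo the 7 printed citations (2 remaining named inputs: hLiu418 =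
`stmt-HodgeConjecture-24832`, h413 = `stmt-HodgeConjecture-24833`) until rung 0 closes.

## References
* [Rogawski1990] J. D. Rogawski, *Automorphic Representations of Unitary Groups in Three Variables*, Ann. of Math. Stud. 123 (1990), §4.9 Prop. 4.9.1 (b) p. 55, Lemma 4.9.3 p. 56; §4.3 (4.3.1) p. 43.
* [LabesseLanglands1979] J.-P. Labesse, R. P. Langlands, *L-indistinguishability for SL(2)*, Canad. J. Math. 31 (1979), §2 (2.1)–(2.2).
* [Kottwitz1986BaseChangeUnits] R. E. Kottwitz, *Base change for unit elements of Hecke algebras*, Compositio Math. 60 (1986), §1 pp. 240–241.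
-/

set_option autoImplicit false

noncomputable section

namespace Summit.HodgeConjecture.HodgeConjecture.Cruxes.H413.F0P3cDyRamLevelsTypeTwoCensusLawOfRecord

open MeasureTheory Measure NumberField IsDedekindDomain Topology Filter
open Literature.NumberTheory.Automorphic Literature.NumberTheory.Automorphic.UnitaryGroup Literature.NumberTheory.Automorphic.IntegralReduction
open Literature.NumberTheory.Rogawski1990 Literature.NumberTheory.GaloisRepresentations
open Literature.NumberTheory.Automorphic.UnitaryThreeFourFrame
open scoped Matrix MatrixGroups Classical Valued
open Literature.NumberTheory.Automorphic.UnitaryLatticeTree Literature.NumberTheory.Automorphic.HermitianLattice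
open Literature.NumberTheory.QuadraticForms
open Summit.HodgeConjecture.HodgeConjecture.Cruxes.H413.F0P3cDyRamToricCensusDefs
open Summit.HodgeConjecture.HodgeConjecture.Cruxes.H413.F0P3cDyRamFourFrameCensusDefs (LatticeInLevel)
open Summit.HodgeConjecture.HodgeConjecture.Cruxes.H413.F0P3cDyRamFourFrameLawDefsR (shiftR)
open Summit.HodgeConjecture.HodgeConjecture.Cruxes.H413.F0P3cDyRamLevelsCensusTypeSplit (levelsCensus2_of_types)
open Summit.HodgeConjecture.HodgeConjecture.Cruxes.H413.F0P3cDyRamLevelsCensusLineModels (levelsCensus4_of_levelsCensus2)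
open Summit.HodgeConjecture.HodgeConjecture.Cruxes.H413.F0P3cDyRamLevelsTypeTwoCensusLawOfSockets (levels_typeTwo_censusLaw_of_levelsCensus4)
open Summit.HodgeConjecture.HodgeConjecture.Cruxes.H413.F0P3cDyRamLevelsCensusUnr (levelsCensusA)
open Summit.HodgeConjecture.HodgeConjecture.Cruxes.H413.F0P3cDyRamLevelsCensusRamK (levelsCensusB)
open Summit.HodgeConjecture.HodgeConjecture.Cruxes.H413

set_option maxHeartbeats 4000000 in
-- budget only: the ≈ 22 k-character RamM lane body + ★ p859606's ≈ 14 k-character letter (★ A: 2 M for four sockets; LH4-p07's lane: 4 M).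
/-- **THE (LAW) END, modulo the RamM lane** (see the module docstring). [cite: Rogawski1990, §4.9 Prop. 4.9.1 (b) p. 55, Lemma 4.9.3 p. 56; §4.3 (4.3.1) p. 43] [cite: LabesseLanglands1979, §2 (2.1)–(2.2)] [cite: Kottwitz1986BaseChangeUnits, §1 pp. 240–241] -/
theorem levels_typeTwo_censusLaw (L : Type) [Field L] [NumberField L] [IsCMField L]
    {v : HeightOneSpectrum (𝓞 ↥(maximalRealSubfield L))} (w : UnitaryGroup.PlacesOver L v)
    (hw : IsCMField.complexConj L • w.1 = w.1) (he : v.asIdeal.ramificationIdx' w.1.asIdeal ≠ 1)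
    (ϖ : (w.1.adicCompletion L)) (hϖ : Valued.v ϖ = WithZero.exp (-1 : ℤ)) (d tE : ℕ)
    (hD : IsRamifiedQuadraticDatum (galAdicCompletionMap (L := L) (IsCMField.complexConj L) hw) ϖ d tE)
    (h2v : Valued.v (2 : (w.1.adicCompletion L)) < 1)
    [Fintype (Valued.ResidueField (w.1.adicCompletion L))]
    [MeasurableSpace ((UnitaryGroup.cmDatum L 3 (Matrix.of fun i j : Fin 3 => if i.val + j.val + 1 = 3 then (1 : L) else 0)).Local v)]
    (νG₃ : Measure ((UnitaryGroup.cmDatum L 3 (Matrix.of fun i j : Fin 3 => if i.val + j.val + 1 = 3 then (1 : L) else 0)).Local v))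
    (a b ks bs : ℕ) (had : a ≤ d) (hab1 : d + 2 * a ≤ b + 1)
    (hks : 2 * ks + 2 * ((d + a % 2) / 2) = a + a % 2 + (b + b % 2))
    (hbs0 : a % 2 = 0 → bs + a = ks) (hbs1 : a % 2 = 1 → bs + a + 1 = ks + 2 * (d % 2))
    (hC :
      ∃ V ∈ 𝓝 (1 : ((UnitaryGroup.cmDatum L 2 (Matrix.of fun i j : Fin 2 => if i.val + j.val + 1 = 2 then (1 : L) else 0)).Local v × (UnitaryGroup.cmDatum L 1 (Matrix.of fun i j : Fin 1 => if i.val + j.val + 1 = 1 then (1 : L) else 0)).Local v)), ∀ γH ∈ V, IsLocalGRegular L v γH → ¬ (∃ x : (w.1.adicCompletion L), (((((γH).1.val : GL (Fin 2) (UnitaryGroup.LocalRing L v)).val.map (Pi.evalRingHom (fun w' : UnitaryGroup.PlacesOver L v => w'.1.adicCompletion L) w))).charpoly).IsRoot x) → ∀ (E' : Type) [Field E'] [NumberField E'] [Algebra L E'] [Algebra.IsQuadraticExtension L E'] (c₁ : E' ≃ₐ[L] E') (δ : E') (m₀ : L) (s : (w.1.adicCompletion L)) (w₁ : UnitaryGroup.PlacesOver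 E' w.1) (hw₁ : c₁ • w₁.1 = w₁.1) (Θ : (w₁.1.adicCompletion E') →+* (w₁.1.adicCompletion E')) (α lam : (w₁.1.adicCompletion E')), c₁ ≠ 1 → c₁ δ = -δ → δ ≠ 0 → algebraMap L E' m₀ = δ ^ 2 → s ≠ 0 → (((γH.1.val : GL (Fin 2) (UnitaryGroup.LocalRing L v)).val.map (Pi.evalRingHom (fun w' : UnitaryGroup.PlacesOver L v => w'.1.adicCompletion L) w))).trace * (((γH.1.val : GL (Fin 2) (UnitaryGroup.LocalRing L v)).val.map (Pi.evalRingHom (fun w' : UnitaryGroup.PlacesOver L v => w'.1.adicCompletion L) w))).trace - 4 * (((γH.1.val : GL (Fin 2) (UnitaryGroup.LocalRing L v)).val.map (Pi.evalRingHom (fun w' : UnitaryGroup.PlacesOver L v => w'.1.adicCompletion L) w))).det = s * s * ((m₀ : L) : (w.1.adicCompletion L)) →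
      (((γH.1.val : GL (Fin 2) (UnitaryGroup.LocalRing L v)).val.map (Pi.evalRingHom (fun w' : UnitaryGroup.PlacesOver L v => w'.1.adicCompletion L) w))).det * (galAdicCompletionMap (L := L) (IsCMField.complexConj L) hw) (((γH.1.val : GL (Fin 2) (UnitaryGroup.LocalRing L v)).val.map (Pi.evalRingHom (fun w' : UnitaryGroup.PlacesOver L v => w'.1.adicCompletion L) w))).det = 1 → (((γH.1.val : GL (Fin 2) (UnitaryGroup.LocalRing L v)).val.map (Pi.evalRingHom (fun w' : UnitaryGroup.PlacesOver L v => w'.1.adicCompletion L) w))).trace = (((γH.1.val : GL (Fin 2) (UnitaryGroup.LocalRing L v)).val.map (Pi.evalRingHom (fun w' : UnitaryGroup.PlacesOver L v => w'.1.adicCompletion L) w))).det * (galAdicCompletionMap (L := L) (IsCMField.complexConj L) hw) (((γH.1.val : GL (Fin 2) (UnitaryGroup.LocalRing L v)).val.map (Pi.evalRingHom (fun w' : UnitaryGroup.PlacesOver L v => w'.1.adicCompletion L) w))).trace → (∀ x : (w.1.adicCompletion L), x * x - (((γH.1.val : GL (Fin 2) (UnitaryGroup.LocalRing L v)).val.map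 (Pi.evalRingHom (fun w' : UnitaryGroup.PlacesOver L v => w'.1.adicCompletion L) w))).trace * x + (((γH.1.val : GL (Fin 2) (UnitaryGroup.LocalRing L v)).val.map (Pi.evalRingHom (fun w' : UnitaryGroup.PlacesOver L v => w'.1.adicCompletion L) w))).det ≠ 0) → (∀ z, galAdicCompletionMap (L := E') c₁ hw₁ (galAdicCompletionMap (L := E') c₁ hw₁ z) = z) → (∀ z, Valued.v (galAdicCompletionMap (L := E') c₁ hw₁ z) = Valued.v z) → (∀ a, galAdicCompletionMap (L := E') c₁ hw₁ (toPlace w.1 w₁ a) = toPlace w.1 w₁ a) → (∀ a, Valued.v (toPlace w.1 w₁ a) ≤ 1 ↔ Valued.v a ≤ 1) → (∀ z : (w₁.1.adicCompletion E'), galAdicCompletionMap (L := E') c₁ hw₁ z = z ↔ ∃ a, toPlace w.1 w₁ a = z) → (∀ a, Θ (toPlace w.1 w₁ a) = toPlace w.1 w₁ ((galAdicCompletionMap (L := L) (IsCMField.complexConj L) hw) a)) → (∀ z, Θ (Θ z) = z) →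
      (∀ z, Θ (galAdicCompletionMap (L := E') c₁ hw₁ z) = galAdicCompletionMap (L := E') c₁ hw₁ (Θ z)) → (∀ z, Valued.v (Θ z) = Valued.v z) → galAdicCompletionMap (L := E') c₁ hw₁ α ≠ α → Valued.v α ≤ 1 → (∀ z : (w₁.1.adicCompletion E'), Valued.v z ≤ 1 → Valued.v ((z - galAdicCompletionMap (L := E') c₁ hw₁ z) / (α - galAdicCompletionMap (L := E') c₁ hw₁ α)) ≤ 1) → 2 * lam = toPlace w.1 w₁ (((γH.1.val : GL (Fin 2) (UnitaryGroup.LocalRing L v)).val.map (Pi.evalRingHom (fun w' : UnitaryGroup.PlacesOver L v => w'.1.adicCompletion L) w))).trace + toPlace w.1 w₁ s * ((δ : E') : (w₁.1.adicCompletion E')) → lam * lam = toPlace w.1 w₁ (((γH.1.val : GL (Fin 2) (UnitaryGroup.LocalRing L v)).val.map (Pi.evalRingHom (fun w' : UnitaryGroup.PlacesOver L v => w'.1.adicCompletion L) w))).trace * lam - toPlace w.1 w₁ (((γH.1.val : GL (Fin 2) (UnitaryGroup.LocalRing L v)).val.map (Pi.evalRingHom (fun w' : UnitaryGroup.PlacesOver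 L v => w'.1.adicCompletion L) w))).det → galAdicCompletionMap (L := E') c₁ hw₁ lam = toPlace w.1 w₁ (((γH.1.val : GL (Fin 2) (UnitaryGroup.LocalRing L v)).val.map (Pi.evalRingHom (fun w' : UnitaryGroup.PlacesOver L v => w'.1.adicCompletion L) w))).trace - lam → Θ lam * lam = 1 → Valued.v lam = 1 → (∀ z : (w₁.1.adicCompletion E'), ∃! pq : (w.1.adicCompletion L) × (w.1.adicCompletion L), z = toPlace w.1 w₁ pq.1 + toPlace w.1 w₁ pq.2 * lam) → Valued.v (α - (galAdicCompletionMap (L := E') c₁ hw₁) α) < 1 → ∀ (th ta : ((UnitaryGroup.cmDatum L 3 (Matrix.of fun i j : Fin 3 => if i.val + j.val + 1 = 3 then (1 : L) else 0)).Local v)) (P₁ : GL (Fin 3) (w.1.adicCompletion L)) (dg : Fin 2 → (w.1.adicCompletion L)) (η : (w.1.adicCompletion L)) (γ₁ : GL (Fin 2) (w.1.adicCompletion L)),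
      ((localNonsplitEquiv (IsCMField.complexConj L) (Matrix.of fun i j : Fin 3 => if i.val + j.val + 1 = 3 then (1 : L) else 0) (IsCMField.complexConj_ne_one L) w hw th : ↥(unitaryGroupOfForm (galAdicCompletionMap (L := L) (IsCMField.complexConj L) hw) (placeForm (Matrix.of fun i j : Fin 3 => if i.val + j.val + 1 = 3 then (1 : L) else 0) w.1))) : GL (Fin 3) (w.1.adicCompletion L)) = endoGL (((localNonsplitEquiv (IsCMField.complexConj L) (Matrix.of fun i j : Fin 2 => if i.val + j.val + 1 = 2 then (1 : L) else 0) (IsCMField.complexConj_ne_one L) w hw γH.1 : ↥(unitaryGroupOfForm (galAdicCompletionMap (L := L) (IsCMField.complexConj L) hw) (placeForm (Matrix.of fun i j : Fin 2 => if i.val + j.val + 1 = 2 then (1 : L) else 0) w.1))) : GL (Fin 2) (w.1.adicCompletion L)), ((localNonsplitEquiv (IsCMField.complexConj L) (Matrix.of fun i j : Fin 1 => if i.val + j.val + 1 = 1 then (1 : L) else 0) (IsCMField.complexConj_ne_one L) w hw γH.2).val : GL (Fin 1) (w.1.adicCompletion L))) → ((localNonsplitEquiv (IsCMField.complexConj L)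 (Matrix.of fun i j : Fin 3 => if i.val + j.val + 1 = 3 then (1 : L) else 0) (IsCMField.complexConj_ne_one L) w hw ta : ↥(unitaryGroupOfForm (galAdicCompletionMap (L := L) (IsCMField.complexConj L) hw) (placeForm (Matrix.of fun i j : Fin 3 => if i.val + j.val + 1 = 3 then (1 : L) else 0) w.1))) : GL (Fin 3) (w.1.adicCompletion L)) = P₁ * endoGL (γ₁, ((localNonsplitEquiv (IsCMField.complexConj L) (Matrix.of fun i j : Fin 1 => if i.val + j.val + 1 = 1 then (1 : L) else 0) (IsCMField.complexConj_ne_one L) w hw γH.2).val : GL (Fin 1) (w.1.adicCompletion L))) * P₁⁻¹ →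
      formCongr (galAdicCompletionMap (L := L) (IsCMField.complexConj L) hw) P₁ (placeForm (Matrix.of fun i j : Fin 3 => if i.val + j.val + 1 = 3 then (1 : L) else 0) w.1) = (!![(Matrix.diagonal dg) 0 0, 0, (Matrix.diagonal dg) 0 1; 0, η, 0; (Matrix.diagonal dg) 1 0, 0, (Matrix.diagonal dg) 1 1] : Matrix (Fin 3) (Fin 3) (w.1.adicCompletion L)) → (∀ i, Valued.v (dg i) = 1) → (∀ i, (galAdicCompletionMap (L := L) (IsCMField.complexConj L) hw) (dg i) = dg i) → (galAdicCompletionMap (L := L) (IsCMField.complexConj L) hw) η = η → Valued.v η = 1 → (¬ ∃ t : (w.1.adicCompletion L), t * (galAdicCompletionMap (L := L) (IsCMField.complexConj L) hw) t = η) → γ₁ ∈ unitaryGroupOfForm (galAdicCompletionMap (L := L) (IsCMField.complexConj L) hw) (Matrix.diagonal dg) → (γ₁ : Matrix (Fin 2) (Fin 2) (w.1.adicCompletion L)).charpoly = (((γH.1.val : GL (Fin 2) (UnitaryGroup.LocalRing L v)).val.map (Pi.evalRingHom (fun w' : UnitaryGroup.PlacesOver L v => w'.1.adicCompletion L) w))).charpoly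 → ∀ (φ : (Fin 2 → (w.1.adicCompletion L)) →+ (w₁.1.adicCompletion E')) (h : (w₁.1.adicCompletion E')) (φ' : (Fin 2 → (w.1.adicCompletion L)) →+ (w₁.1.adicCompletion E')) (h' : (w₁.1.adicCompletion E')), (∀ (c : (w.1.adicCompletion L)) (x : Fin 2 → (w.1.adicCompletion L)), φ (c • x) = toPlace w.1 w₁ c * φ x) → Function.Injective φ → Function.Surjective φ → (∀ x, φ ((((localNonsplitEquiv (IsCMField.complexConj L) (Matrix.of fun i j : Fin 2 => if i.val + j.val + 1 = 2 then (1 : L) else 0) (IsCMField.complexConj_ne_one L) w hw γH.1 : ↥(unitaryGroupOfForm (galAdicCompletionMap (L := L) (IsCMField.complexConj L) hw) (placeForm (Matrix.of fun i j : Fin 2 => if i.val + j.val + 1 = 2 then (1 : L) else 0) w.1))) : GL (Fin 2) (w.1.adicCompletion L)) : Matrix (Fin 2) (Fin 2) (w.1.adicCompletion L)).mulVec x) = lam * φ x) →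
      (∀ x y, toPlace w.1 w₁ (pairing (galAdicCompletionMap (L := L) (IsCMField.complexConj L) hw) (placeForm (Matrix.of fun i j : Fin 2 => if i.val + j.val + 1 = 2 then (1 : L) else 0) w.1) x y) = h * Θ (φ x) * φ y + galAdicCompletionMap (L := E') c₁ hw₁ (h * Θ (φ x) * φ y)) → Θ h = h → h ≠ 0 → (∃ x : (w₁.1.adicCompletion E'), x ≠ 0 ∧ h * Θ x * x + galAdicCompletionMap (L := E') c₁ hw₁ (h * Θ x * x) = 0) → (∀ (c : (w.1.adicCompletion L)) (x : Fin 2 → (w.1.adicCompletion L)), φ' (c • x) = toPlace w.1 w₁ c * φ' x) → Function.Injective φ' → Function.Surjective φ' → (∀ x, φ' ((γ₁ : Matrix (Fin 2) (Fin 2) (w.1.adicCompletion L)).mulVec x) = lam * φ' x) → (∀ x y, toPlace w.1 w₁ (pairing (galAdicCompletionMap (L := L) (IsCMField.complexConj L) hw) (Matrix.diagonal dg) x y) = h' * Θ (φ' x) * φ' y + galAdicCompletionMap (L := E') c₁ hw₁ (h' * Θ (φ' x) * φ' y)) → Θ h' = h' → h' ≠ 0 → (∀ (t : (w.1.adicCompletion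 L)) (n : ℤ), Valued.v (toPlace w.1 w₁ t) = Valued.v (toPlace w.1 w₁ ϖ) ^ n ↔ Valued.v t = Valued.v ϖ ^ n) → (∀ c : (w₁.1.adicCompletion E'), galAdicCompletionMap (L := E') c₁ hw₁ c = c → c ≠ 0 → Valued.v c ≤ 1 → ∃ n : ℕ, Valued.v c = Valued.v (toPlace w.1 w₁ ϖ) ^ n) → (∀ t : (w₁.1.adicCompletion E'), galAdicCompletionMap (L := E') c₁ hw₁ t = t → Valued.v t < 1 → Valued.v t ≤ Valued.v (toPlace w.1 w₁ ϖ)) → ∀ (J R R' : ℕ) (f f' : ℕ → ℕ → AddSubgroup (w₁.1.adicCompletion E') → ℕ),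
      {M₃ : Submodule (Valued.integer (w.1.adicCompletion L)) (Fin 3 → (w.1.adicCompletion L)) | IsVertexLattice (galAdicCompletionMap (L := L) (IsCMField.complexConj L) hw) ϖ ((StdForm.antidiagonal 3).over (w.1.adicCompletion L)) 0 M₃ ∧ mapGL (endoGL (((localNonsplitEquiv (IsCMField.complexConj L) (Matrix.of fun i j : Fin 2 => if i.val + j.val + 1 = 2 then (1 : L) else 0) (IsCMField.complexConj_ne_one L) w hw γH.1 : ↥(unitaryGroupOfForm (galAdicCompletionMap (L := L) (IsCMField.complexConj L) hw) (placeForm (Matrix.of fun i j : Fin 2 => if i.val + j.val + 1 = 2 then (1 : L) else 0) w.1))) : GL (Fin 2) (w.1.adicCompletion L)), ((localNonsplitEquiv (IsCMField.complexConj L) (Matrix.of fun i j : Fin 1 => if i.val + j.val + 1 = 1 then (1 : L) else 0) (IsCMField.complexConj_ne_one L) w hw γH.2).val : GL (Fin 1) (w.1.adicCompletion L)))) M₃ = M₃}.Finite → (∀ M₃ : Submodule (Valued.integer (w.1.adicCompletion L)) (Fin 3 → (w.1.adicCompletion L)), IsVertexLattice (galAdicCompletionMap (L := L) (IsCMField.complexConj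 L) hw) ϖ ((StdForm.antidiagonal 3).over (w.1.adicCompletion L)) 0 M₃ → mapGL (endoGL (((localNonsplitEquiv (IsCMField.complexConj L) (Matrix.of fun i j : Fin 2 => if i.val + j.val + 1 = 2 then (1 : L) else 0) (IsCMField.complexConj_ne_one L) w hw γH.1 : ↥(unitaryGroupOfForm (galAdicCompletionMap (L := L) (IsCMField.complexConj L) hw) (placeForm (Matrix.of fun i j : Fin 2 => if i.val + j.val + 1 = 2 then (1 : L) else 0) w.1))) : GL (Fin 2) (w.1.adicCompletion L)), ((localNonsplitEquiv (IsCMField.complexConj L) (Matrix.of fun i j : Fin 1 => if i.val + j.val + 1 = 1 then (1 : L) else 0) (IsCMField.complexConj_ne_one L) w hw γH.2).val : GL (Fin 1) (w.1.adicCompletion L)))) M₃ = M₃ → ∀ b : ℕ, (∀ c : (w.1.adicCompletion L), (Pi.single 1 c : Fin 3 → (w.1.adicCompletion L)) ∈ M₃ ↔ Valued.v c ≤ Valued.v ϖ ^ b) → b ≤ R) →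
      {M₃ : Submodule (Valued.integer (w.1.adicCompletion L)) (Fin 3 → (w.1.adicCompletion L)) | IsSelfDualLattice (galAdicCompletionMap (L := L) (IsCMField.complexConj L) hw) ϖ (!![(Matrix.diagonal dg) 0 0, 0, (Matrix.diagonal dg) 0 1; 0, η, 0; (Matrix.diagonal dg) 1 0, 0, (Matrix.diagonal dg) 1 1] : Matrix (Fin 3) (Fin 3) (w.1.adicCompletion L)) M₃ ∧ mapGL (endoGL (γ₁, ((localNonsplitEquiv (IsCMField.complexConj L) (Matrix.of fun i j : Fin 1 => if i.val + j.val + 1 = 1 then (1 : L) else 0) (IsCMField.complexConj_ne_one L) w hw γH.2).val : GL (Fin 1) (w.1.adicCompletion L)))) M₃ = M₃}.Finite → (∀ M₃ : Submodule (Valued.integer (w.1.adicCompletion L)) (Fin 3 → (w.1.adicCompletion L)), IsSelfDualLattice (galAdicCompletionMap (L := L) (IsCMField.complexConj L) hw) ϖ (!![(Matrix.diagonal dg) 0 0, 0, (Matrix.diagonal dg) 0 1; 0, η, 0; (Matrix.diagonal dg) 1 0, 0, (Matrix.diagonal dg) 1 1] : Matrix (Fin 3) (Fin 3) (w.1.adicCompletion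 L)) M₃ → mapGL (endoGL (γ₁, ((localNonsplitEquiv (IsCMField.complexConj L) (Matrix.of fun i j : Fin 1 => if i.val + j.val + 1 = 1 then (1 : L) else 0) (IsCMField.complexConj_ne_one L) w hw γH.2).val : GL (Fin 1) (w.1.adicCompletion L)))) M₃ = M₃ → ∀ b : ℕ, (∀ c : (w.1.adicCompletion L), (Pi.single 1 c : Fin 3 → (w.1.adicCompletion L)) ∈ M₃ ↔ Valued.v c ≤ Valued.v ϖ ^ b) → b ≤ R') → ¬ IsOrd (galAdicCompletionMap (L := E') c₁ hw₁) α (toPlace w.1 w₁ ϖ ^ (J + 1)) lam → (∀ j a, (levelSet (galAdicCompletionMap (L := E') c₁ hw₁) Θ α (toPlace w.1 w₁ ϖ) h j a).Finite) → (∀ j a, (levelSet (galAdicCompletionMap (L := E') c₁ hw₁) Θ α (toPlace w.1 w₁ ϖ) h' j a).Finite) → Valued.v ((((localNonsplitEquiv (IsCMField.complexConj L) (Matrix.of fun i j : Fin 1 => if i.val + j.val + 1 = 1 then (1 : L) else 0) (IsCMField.complexConj_ne_one L) w hw γH.2).val : GL (Fin 1) (w.1.adicCompletion L)) : Matrix (Fin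 1) (Fin 1) (w.1.adicCompletion L)) 0 0) = 1 →
      (∀ (b j : ℕ) (Λ : AddSubgroup (w₁.1.adicCompletion E')) (x₀ : (w₁.1.adicCompletion E')) (r : (w.1.adicCompletion L)), 1 ≤ b → x₀ ≠ 0 → (∀ x, x ∈ Λ ↔ ∃ z, IsOrd (galAdicCompletionMap (L := E') c₁ hw₁) α (toPlace w.1 w₁ ϖ ^ j) z ∧ x = x₀ * z) → IsOrd (galAdicCompletionMap (L := E') c₁ hw₁) α (toPlace w.1 w₁ ϖ ^ j) (dualGen (galAdicCompletionMap (L := E') c₁ hw₁) Θ α (toPlace w.1 w₁ ϖ ^ j) h x₀) → ¬ IsOrd (galAdicCompletionMap (L := E') c₁ hw₁) α (toPlace w.1 w₁ ϖ ^ j) (dualGen (galAdicCompletionMap (L := E') c₁ hw₁) Θ α (toPlace w.1 w₁ ϖ ^ j) h x₀ / toPlace w.1 w₁ ϖ) → Valued.v (dualGen (galAdicCompletionMap (L := E') c₁ hw₁) Θ α (toPlace w.1 w₁ ϖ ^ j) h x₀) = Valued.v (toPlace w.1 w₁ ϖ) ^ b → (∀ b', (∀ x ∈ Λ, Valued.v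 (h * Θ x * b' + galAdicCompletionMap (L := E') c₁ hw₁ (h * Θ x * b')) ≤ 1) → (lam - toPlace w.1 w₁ ((((localNonsplitEquiv (IsCMField.complexConj L) (Matrix.of fun i j : Fin 1 => if i.val + j.val + 1 = 1 then (1 : L) else 0) (IsCMField.complexConj_ne_one L) w hw γH.2).val : GL (Fin 1) (w.1.adicCompletion L)) : Matrix (Fin 1) (Fin 1) (w.1.adicCompletion L)) 0 0)) * b' ∈ Λ) → IsOrd (galAdicCompletionMap (L := E') c₁ hw₁) α (toPlace w.1 w₁ ϖ ^ j) lam → toPlace w.1 w₁ r = glueUnit (galAdicCompletionMap (L := E') c₁ hw₁) Θ α (toPlace w.1 w₁ ϖ ^ j) h (toPlace w.1 w₁ ϖ) (toPlace w.1 w₁ 1) x₀ b → f b j Λ = Nat.card {x : 𝒪[(w.1.adicCompletion L)] ⧸ 𝓂[(w.1.adicCompletion L)] ^ (2 * b) // ∃ u' : 𝒪[(w.1.adicCompletion L)], Ideal.Quotient.mk (𝓂[(w.1.adicCompletion L)] ^ (2 * b)) u' = x ∧ Valued.v ((u' : (w.1.adicCompletion L)) * (galAdicCompletionMap (L := L)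 (IsCMField.complexConj L) hw) u' - r) ≤ Valued.v (ϖ ^ (2 * b))}) → (∀ (b j : ℕ) (Λ : AddSubgroup (w₁.1.adicCompletion E')) (x₀ : (w₁.1.adicCompletion E')) (r : (w.1.adicCompletion L)), 1 ≤ b → x₀ ≠ 0 → (∀ x, x ∈ Λ ↔ ∃ z, IsOrd (galAdicCompletionMap (L := E') c₁ hw₁) α (toPlace w.1 w₁ ϖ ^ j) z ∧ x = x₀ * z) →
      IsOrd (galAdicCompletionMap (L := E') c₁ hw₁) α (toPlace w.1 w₁ ϖ ^ j) (dualGen (galAdicCompletionMap (L := E') c₁ hw₁) Θ α (toPlace w.1 w₁ ϖ ^ j) h' x₀) → ¬ IsOrd (galAdicCompletionMap (L := E') c₁ hw₁) α (toPlace w.1 w₁ ϖ ^ j) (dualGen (galAdicCompletionMap (L := E') c₁ hw₁) Θ α (toPlace w.1 w₁ ϖ ^ j) h' x₀ / toPlace w.1 w₁ ϖ) → Valued.v (dualGen (galAdicCompletionMap (L := E') c₁ hw₁) Θ α (toPlace w.1 w₁ ϖ ^ j) h' x₀) = Valued.v (toPlace w.1 w₁ ϖ) ^ b → (∀ b', (∀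 x ∈ Λ, Valued.v (h' * Θ x * b' + galAdicCompletionMap (L := E') c₁ hw₁ (h' * Θ x * b')) ≤ 1) → (lam - toPlace w.1 w₁ ((((localNonsplitEquiv (IsCMField.complexConj L) (Matrix.of fun i j : Fin 1 => if i.val + j.val + 1 = 1 then (1 : L) else 0) (IsCMField.complexConj_ne_one L) w hw γH.2).val : GL (Fin 1) (w.1.adicCompletion L)) : Matrix (Fin 1) (Fin 1) (w.1.adicCompletion L)) 0 0)) * b' ∈ Λ) → IsOrd (galAdicCompletionMap (L := E') c₁ hw₁) α (toPlace w.1 w₁ ϖ ^ j) lam → toPlace w.1 w₁ r = glueUnit (galAdicCompletionMap (L := E') c₁ hw₁) Θ α (toPlace w.1 w₁ ϖ ^ j) h' (toPlace w.1 w₁ ϖ) (toPlace w.1 w₁ η) x₀ b → f' b j Λ = Nat.card {x : 𝒪[(w.1.adicCompletion L)] ⧸ 𝓂[(w.1.adicCompletion L)] ^ (2 * b) // ∃ u' : 𝒪[(w.1.adicCompletion L)], Ideal.Quotient.mk (𝓂[(w.1.adicCompletion L)] ^ (2 * b)) u' = x ∧ Valued.v ((u' : (w.1.adicCompletion L)) *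 (galAdicCompletionMap (L := L) (IsCMField.complexConj L) hw) u' - r) ≤ Valued.v (ϖ ^ (2 * b))}) → (∀ f₀ : (w₁.1.adicCompletion E'), galAdicCompletionMap (L := E') c₁ hw₁ f₀ = f₀ → Θ f₀ = f₀ → Valued.v f₀ = 1 → ∃ z : (w₁.1.adicCompletion E'), z * Θ z = f₀) ∧ (∀ (m : ℕ) (β : (v.adicCompletion ↥(maximalRealSubfield L))ˣ), Valued.v (((finCharpolyTwo L v γH).eval (finGammaTwo L v γH)) w) = Valued.v ((toPlace v w (HeckeCharacter.uniformizer ↥(maximalRealSubfield L) v : v.adicCompletion ↥(maximalRealSubfield L))) ^ m) →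
      toPlace v w (β : (v.adicCompletion ↥(maximalRealSubfield L))) = -(((finCharpolyTwo L v γH).eval (finGammaTwo L v γH)) w * (finGammaTwo L v γH w ^ 2 + ((γH.1.val.val : Matrix (Fin 2) (Fin 2) (UnitaryGroup.LocalRing L v)).map (Pi.evalRingHom (fun w' : UnitaryGroup.PlacesOver L v => w'.1.adicCompletion L) w)).det)) / (2 * finGammaTwo L v γH w ^ 2 * ((γH.1.val.val : Matrix (Fin 2) (Fin 2) (UnitaryGroup.LocalRing L v)).map (Pi.evalRingHom (fun w' : UnitaryGroup.PlacesOver L v => w'.1.adicCompletion L) w)).det) → (((Fintype.card (Valued.ResidueField (w.1.adicCompletion L))) : ℤ) - 1) * ((Fintype.card (Valued.ResidueField (w.1.adicCompletion L))) : ℤ) ^ ks * ((({M : Submodule (Valued.integer (w.1.adicCompletion L)) (Fin 3 → w.1.adicCompletion L) | IsVertexLattice (galAdicCompletionMap (L := L) (IsCMField.complexConj L) hw) ϖ ((StdForm.antidiagonal 3).over (w.1.adicCompletion L)) 0 M ∧ mapGL ((localNonsplitEquiv (IsCMField.complexConj L) (Matrix.of fun i j : Fin 3 => if i.val + j.val +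 1 = 3 then (1 : L) else 0) (IsCMField.complexConj_ne_one L) w hw th : ↥(unitaryGroupOfForm (galAdicCompletionMap (L := L) (IsCMField.complexConj L) hw) (placeForm (Matrix.of fun i j : Fin 3 => if i.val + j.val + 1 = 3 then (1 : L) else 0) w.1))) : GL (Fin 3) (w.1.adicCompletion L)) M = M ∧ (LatticeInLevel ϖ a ((((localNonsplitEquiv (IsCMField.complexConj L) (Matrix.of fun i j : Fin 3 => if i.val + j.val + 1 = 3 then (1 : L) else 0) (IsCMField.complexConj_ne_one L) w hw th : ↥(unitaryGroupOfForm (galAdicCompletionMap (L := L) (IsCMField.complexConj L) hw) (placeForm (Matrix.of fun i j : Fin 3 => if i.val + j.val + 1 = 3 then (1 : L) else 0) w.1))) : GL (Fin 3) (w.1.adicCompletion L)) : Matrix (Fin 3) (Fin 3) (w.1.adicCompletion L)) - 1) M ∧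
      LatticeInLevel ϖ b (((((localNonsplitEquiv (IsCMField.complexConj L) (Matrix.of fun i j : Fin 3 => if i.val + j.val + 1 = 3 then (1 : L) else 0) (IsCMField.complexConj_ne_one L) w hw th : ↥(unitaryGroupOfForm (galAdicCompletionMap (L := L) (IsCMField.complexConj L) hw) (placeForm (Matrix.of fun i j : Fin 3 => if i.val + j.val + 1 = 3 then (1 : L) else 0) w.1))) : GL (Fin 3) (w.1.adicCompletion L)) : Matrix (Fin 3) (Fin 3) (w.1.adicCompletion L)) - 1) * ((((localNonsplitEquiv (IsCMField.complexConj L) (Matrix.of fun i j : Fin 3 => if i.val + j.val + 1 = 3 then (1 : L) else 0) (IsCMField.complexConj_ne_one L) w hw th : ↥(unitaryGroupOfForm (galAdicCompletionMap (L := L) (IsCMField.complexConj L) hw) (placeForm (Matrix.of fun i j : Fin 3 => if i.val + j.val + 1 = 3 then (1 : L) else 0) w.1))) : GL (Fin 3) (w.1.adicCompletion L)) : Matrix (Fin 3) (Fin 3) (w.1.adicCompletion L)) - 1)) M)}.ncard : ℕ) : ℤ) - (({M : Submodule (Valued.integer (w.1.adicCompletion L)) (Fin 3 → w.1.adicCompletion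 L) | IsVertexLattice (galAdicCompletionMap (L := L) (IsCMField.complexConj L) hw) ϖ ((StdForm.antidiagonal 3).over (w.1.adicCompletion L)) 0 M ∧ mapGL ((localNonsplitEquiv (IsCMField.complexConj L) (Matrix.of fun i j : Fin 3 => if i.val + j.val + 1 = 3 then (1 : L) else 0) (IsCMField.complexConj_ne_one L) w hw ta : ↥(unitaryGroupOfForm (galAdicCompletionMap (L := L) (IsCMField.complexConj L) hw) (placeForm (Matrix.of fun i j : Fin 3 => if i.val + j.val + 1 = 3 then (1 : L) else 0) w.1))) : GL (Fin 3) (w.1.adicCompletion L)) M = M ∧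
      (LatticeInLevel ϖ a ((((localNonsplitEquiv (IsCMField.complexConj L) (Matrix.of fun i j : Fin 3 => if i.val + j.val + 1 = 3 then (1 : L) else 0) (IsCMField.complexConj_ne_one L) w hw ta : ↥(unitaryGroupOfForm (galAdicCompletionMap (L := L) (IsCMField.complexConj L) hw) (placeForm (Matrix.of fun i j : Fin 3 => if i.val + j.val + 1 = 3 then (1 : L) else 0) w.1))) : GL (Fin 3) (w.1.adicCompletion L)) : Matrix (Fin 3) (Fin 3) (w.1.adicCompletion L)) - 1) M ∧ LatticeInLevel ϖ b (((((localNonsplitEquiv (IsCMField.complexConj L) (Matrix.of fun i j : Fin 3 => if i.val + j.val + 1 = 3 then (1 : L) else 0) (IsCMField.complexConj_ne_one L) w hw ta : ↥(unitaryGroupOfForm (galAdicCompletionMap (L := L) (IsCMField.complexConj L) hw) (placeForm (Matrix.of fun i j : Fin 3 => if i.val + j.val + 1 = 3 then (1 : L) else 0) w.1))) : GL (Fin 3) (w.1.adicCompletion L)) : Matrix (Fin 3) (Fin 3) (w.1.adicCompletion L)) - 1) * ((((localNonsplitEquiv (IsCMField.complexConj L) (Matrix.of fun i j : Fin 3 =>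 if i.val + j.val + 1 = 3 then (1 : L) else 0) (IsCMField.complexConj_ne_one L) w hw ta : ↥(unitaryGroupOfForm (galAdicCompletionMap (L := L) (IsCMField.complexConj L) hw) (placeForm (Matrix.of fun i j : Fin 3 => if i.val + j.val + 1 = 3 then (1 : L) else 0) w.1))) : GL (Fin 3) (w.1.adicCompletion L)) : Matrix (Fin 3) (Fin 3) (w.1.adicCompletion L)) - 1)) M)}.ncard : ℕ) : ℤ)) = (Literature.NumberTheory.QuadraticForms.hilbertSymbol (v.adicCompletion ↥(maximalRealSubfield L)) (β : (v.adicCompletion ↥(maximalRealSubfield L))) (algebraMap ↥(maximalRealSubfield L) _ ((cmQuadraticGenerator L : 𝓞 ↥(maximalRealSubfield L)) : ↥(maximalRealSubfield L))) : ℤ) * ((Fintype.card (Valued.ResidueField (w.1.adicCompletion L))) : ℤ) ^ m *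
      ((((Fintype.card (Valued.ResidueField (w.1.adicCompletion L))) : ℤ) - 1) * (((Nat.card (MulAction.fixedBy (((UnitaryGroup.cmDatum L 2 (Matrix.of fun i j : Fin 2 => if i.val + j.val + 1 = 2 then (1 : L) else 0)).Local v) ⧸ cmLocalIntegralLevel L 2 (Matrix.of fun i j : Fin 2 => if i.val + j.val + 1 = 2 then (1 : L) else 0) v) γH.1)) + d % 2 : ℕ) : ℤ) + 2 - 2 * ((Fintype.card (Valued.ResidueField (w.1.adicCompletion L))) : ℤ) ^ (d - d % 2 + bs)))) :
    ∃ V ∈ 𝓝 (1 : ((UnitaryGroup.cmDatum L 2 (Matrix.of fun i j : Fin 2 => if i.val + j.val + 1 = 2 then (1 : L) else 0)).Local v × (UnitaryGroup.cmDatum L 1 (Matrix.of fun i j : Fin 1 => if i.val + j.val + 1 = 1 then (1 : L) else 0)).Local v)), ∀ γH ∈ V, IsLocalGRegular L v γH →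
        ¬ (∃ x : (w.1.adicCompletion L), (((((γH).1.val : GL (Fin 2) (UnitaryGroup.LocalRing L v)).val.map (Pi.evalRingHom (fun w' : UnitaryGroup.PlacesOver L v => w'.1.adicCompletion L) w))).charpoly).IsRoot x) →
        ∀ (th ta : ((UnitaryGroup.cmDatum L 3 (Matrix.of fun i j : Fin 3 => if i.val + j.val + 1 = 3 then (1 : L) else 0)).Local v)) (P₁ : GL (Fin 3) (w.1.adicCompletion L)) (dg : Fin 2 → (w.1.adicCompletion L)) (η : (w.1.adicCompletion L)) (γ₁ : GL (Fin 2) (w.1.adicCompletion L)),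
          IsLocalNormPair L (Matrix.of fun i j : Fin 3 => if i.val + j.val + 1 = 3 then (1 : L) else 0) v γH th → finKappaAt L v (Matrix.of fun i j : Fin 3 => if i.val + j.val + 1 = 3 then (1 : L) else 0) γH th = 1 → IsLocalNormPair L (Matrix.of fun i j : Fin 3 => if i.val + j.val + 1 = 3 then (1 : L) else 0) v γH ta → finKappaAt L v (Matrix.of fun i j : Fin 3 => if i.val + j.val + 1 = 3 then (1 : L) else 0) γH ta = -1 →
          ((localNonsplitEquiv (IsCMField.complexConj L) (Matrix.of fun i j : Fin 3 => if i.val + j.val + 1 = 3 then (1 : L) else 0) (IsCMField.complexConj_ne_one L) w hw th : ↥(unitaryGroupOfForm (galAdicCompletionMap (L := L) (IsCMField.complexConj L) hw) (placeForm (Matrix.of fun i j : Fin 3 => if i.val + j.val + 1 = 3 then (1 : L) else 0) w.1))) : GL (Fin 3) (w.1.adicCompletion L)) = endoGL (((localNonsplitEquiv (IsCMField.complexConj L) (Matrix.of fun i j : Fin 2 => if i.val + j.val + 1 = 2 then (1 : L) else 0) (IsCMField.complexConj_ne_one L) w hw γH.1 : ↥(unitaryGroupOfForm (galAdicCompletionMap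 (L := L) (IsCMField.complexConj L) hw) (placeForm (Matrix.of fun i j : Fin 2 => if i.val + j.val + 1 = 2 then (1 : L) else 0) w.1))) : GL (Fin 2) (w.1.adicCompletion L)), ((localNonsplitEquiv (IsCMField.complexConj L) (Matrix.of fun i j : Fin 1 => if i.val + j.val + 1 = 1 then (1 : L) else 0) (IsCMField.complexConj_ne_one L) w hw γH.2).val : GL (Fin 1) (w.1.adicCompletion L))) →
          ((localNonsplitEquiv (IsCMField.complexConj L) (Matrix.of fun i j : Fin 3 => if i.val + j.val + 1 = 3 then (1 : L) else 0) (IsCMField.complexConj_ne_one L) w hw ta : ↥(unitaryGroupOfForm (galAdicCompletionMap (L := L) (IsCMField.complexConj L) hw) (placeForm (Matrix.of fun i j : Fin 3 => if i.val + j.val + 1 = 3 then (1 : L) else 0) w.1))) : GL (Fin 3) (w.1.adicCompletion L)) = P₁ * endoGL (γ₁, ((localNonsplitEquiv (IsCMField.complexConj L) (Matrix.of fun i j : Fin 1 => if i.val + j.val + 1 = 1 then (1 : L) else 0) (IsCMField.complexConj_ne_one L) w hw γH.2).val : GL (Fin 1) (w.1.adicCompletion L))) * P₁⁻¹ →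
          formCongr (galAdicCompletionMap (L := L) (IsCMField.complexConj L) hw) P₁ (placeForm (Matrix.of fun i j : Fin 3 => if i.val + j.val + 1 = 3 then (1 : L) else 0) w.1) = (!![(Matrix.diagonal dg) 0 0, 0, (Matrix.diagonal dg) 0 1; 0, η, 0; (Matrix.diagonal dg) 1 0, 0, (Matrix.diagonal dg) 1 1] : Matrix (Fin 3) (Fin 3) (w.1.adicCompletion L)) →
          (∀ i, Valued.v (dg i) = 1) → (∀ i, (galAdicCompletionMap (L := L) (IsCMField.complexConj L) hw) (dg i) = dg i) →
          (galAdicCompletionMap (L := L) (IsCMField.complexConj L) hw) η = η → Valued.v η = 1 → (¬ ∃ t : (w.1.adicCompletion L), t * (galAdicCompletionMap (L := L) (IsCMField.complexConj L) hw) t = η) →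
          γ₁ ∈ unitaryGroupOfForm (galAdicCompletionMap (L := L) (IsCMField.complexConj L) hw) (Matrix.diagonal dg) →
          (γ₁ : Matrix (Fin 2) (Fin 2) (w.1.adicCompletion L)).charpoly = ((((γH).1.val : GL (Fin 2) (UnitaryGroup.LocalRing L v)).val.map (Pi.evalRingHom (fun w' : UnitaryGroup.PlacesOver L v => w'.1.adicCompletion L) w))).charpoly →
          ∀ (m : ℕ) (β : (v.adicCompletion ↥(maximalRealSubfield L))ˣ), Valued.v (((finCharpolyTwo L v γH).eval (finGammaTwo L v γH)) w) = Valued.v ((toPlace v w (HeckeCharacter.uniformizer ↥(maximalRealSubfield L) v : v.adicCompletion ↥(maximalRealSubfield L))) ^ m) → toPlace v w (β : v.adicCompletion ↥(maximalRealSubfield L)) = -(((finCharpolyTwo L v γH).eval (finGammaTwo L v γH)) w * (finGammaTwo L v γH w ^ 2 + ((γH.1.val.val : Matrix (Fin 2) (Fin 2) (UnitaryGroup.LocalRing L v)).map (Pi.evalRingHom (fun w' : UnitaryGroup.PlacesOver L v => w'.1.adicCompletion L) w)).det)) / (2 * finGammaTwo L v γH w ^ 2 * ((γH.1.val.val : Matrix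 (Fin 2) (Fin 2) (UnitaryGroup.LocalRing L v)).map (Pi.evalRingHom (fun w' : UnitaryGroup.PlacesOver L v => w'.1.adicCompletion L) w)).det) →
            (Literature.NumberTheory.QuadraticForms.hilbertSymbol (v.adicCompletion ↥(maximalRealSubfield L)) (β : v.adicCompletion ↥(maximalRealSubfield L)) (algebraMap ↥(maximalRealSubfield L) _ ((cmQuadraticGenerator L : 𝓞 ↥(maximalRealSubfield L)) : ↥(maximalRealSubfield L))) : ℂ) * (((Nat.card (𝓞 ↥(maximalRealSubfield L) ⧸ v.asIdeal) : ℂ) ^ m))⁻¹ *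
              (((νG₃ ((cmLocalIntegralLevel L 3 (Matrix.of fun i j : Fin 3 => if i.val + j.val + 1 = 3 then (1 : L) else 0) v) : Set ((UnitaryGroup.cmDatum L 3 (Matrix.of fun i j : Fin 3 => if i.val + j.val + 1 = 3 then (1 : L) else 0)).Local v))).toReal : ℂ) *
                (({M : Submodule (Valued.integer (w.1.adicCompletion L)) (Fin 3 → w.1.adicCompletion L) |
                IsVertexLattice (galAdicCompletionMap (L := L) (IsCMField.complexConj L) hw) ϖ ((StdForm.antidiagonal 3).over (w.1.adicCompletion L)) 0 M ∧
                  mapGL ((localNonsplitEquiv (IsCMField.complexConj L) (Matrix.of fun i j : Fin 3 => if i.val + j.val + 1 = 3 then (1 : L) else 0) (IsCMField.complexConj_ne_one L) w hw th : ↥(unitaryGroupOfForm (galAdicCompletionMap (L := L) (IsCMField.complexConj L) hw) (placeForm (Matrix.of fun i j : Fin 3 => if i.val + j.val + 1 = 3 then (1 : L) else 0) w.1))) : GL (Fin 3) (w.1.adicCompletion L)) M = M ∧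
                  (LatticeInLevel ϖ a ((((localNonsplitEquiv (IsCMField.complexConj L) (Matrix.of fun i j : Fin 3 => if i.val + j.val + 1 = 3 then (1 : L) else 0) (IsCMField.complexConj_ne_one L) w hw th : ↥(unitaryGroupOfForm (galAdicCompletionMap (L := L) (IsCMField.complexConj L) hw) (placeForm (Matrix.of fun i j : Fin 3 => if i.val + j.val + 1 = 3 then (1 : L) else 0) w.1))) : GL (Fin 3) (w.1.adicCompletion L)) : Matrix (Fin 3) (Fin 3) (w.1.adicCompletion L)) - 1) M ∧
                    LatticeInLevel ϖ b (((((localNonsplitEquiv (IsCMField.complexConj L) (Matrix.of fun i j : Fin 3 => if i.val + j.val + 1 = 3 then (1 : L) else 0) (IsCMField.complexConj_ne_one L) w hw th : ↥(unitaryGroupOfForm (galAdicCompletionMap (L := L) (IsCMField.complexConj L) hw) (placeForm (Matrix.of fun i j : Fin 3 => if i.val + j.val + 1 = 3 then (1 : L) else 0) w.1))) : GL (Fin 3) (w.1.adicCompletion L)) : Matrix (Fin 3) (Fin 3) (w.1.adicCompletion L)) - 1) *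
                      ((((localNonsplitEquiv (IsCMField.complexConj L) (Matrix.of fun i j : Fin 3 => if i.val + j.val + 1 = 3 then (1 : L) else 0) (IsCMField.complexConj_ne_one L) w hw th : ↥(unitaryGroupOfForm (galAdicCompletionMap (L := L) (IsCMField.complexConj L) hw) (placeForm (Matrix.of fun i j : Fin 3 => if i.val + j.val + 1 = 3 then (1 : L) else 0) w.1))) : GL (Fin 3) (w.1.adicCompletion L)) : Matrix (Fin 3) (Fin 3) (w.1.adicCompletion L)) - 1)) M)}.ncard : ℂ) -
                 ({M : Submodule (Valued.integer (w.1.adicCompletion L)) (Fin 3 → w.1.adicCompletion L) |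
                IsVertexLattice (galAdicCompletionMap (L := L) (IsCMField.complexConj L) hw) ϖ ((StdForm.antidiagonal 3).over (w.1.adicCompletion L)) 0 M ∧
                  mapGL ((localNonsplitEquiv (IsCMField.complexConj L) (Matrix.of fun i j : Fin 3 => if i.val + j.val + 1 = 3 then (1 : L) else 0) (IsCMField.complexConj_ne_one L) w hw ta : ↥(unitaryGroupOfForm (galAdicCompletionMap (L := L) (IsCMField.complexConj L) hw) (placeForm (Matrix.of fun i j : Fin 3 => if i.val + j.val + 1 = 3 then (1 : L) else 0) w.1))) : GL (Fin 3) (w.1.adicCompletion L)) M = M ∧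
                  (LatticeInLevel ϖ a ((((localNonsplitEquiv (IsCMField.complexConj L) (Matrix.of fun i j : Fin 3 => if i.val + j.val + 1 = 3 then (1 : L) else 0) (IsCMField.complexConj_ne_one L) w hw ta : ↥(unitaryGroupOfForm (galAdicCompletionMap (L := L) (IsCMField.complexConj L) hw) (placeForm (Matrix.of fun i j : Fin 3 => if i.val + j.val + 1 = 3 then (1 : L) else 0) w.1))) : GL (Fin 3) (w.1.adicCompletion L)) : Matrix (Fin 3) (Fin 3) (w.1.adicCompletion L)) - 1) M ∧
                    LatticeInLevel ϖ b (((((localNonsplitEquiv (IsCMField.complexConj L) (Matrix.of fun i j : Fin 3 => if i.val + j.val + 1 = 3 then (1 : L) else 0) (IsCMField.complexConj_ne_one L) w hw ta : ↥(unitaryGroupOfForm (galAdicCompletionMap (L := L) (IsCMField.complexConj L) hw) (placeForm (Matrix.of fun i j : Fin 3 => if i.val + j.val + 1 = 3 then (1 : L) else 0) w.1))) : GL (Fin 3) (w.1.adicCompletion L)) : Matrix (Fin 3) (Fin 3) (w.1.adicCompletion L)) - 1) *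
                      ((((localNonsplitEquiv (IsCMField.complexConj L) (Matrix.of fun i j : Fin 3 => if i.val + j.val + 1 = 3 then (1 : L) else 0) (IsCMField.complexConj_ne_one L) w hw ta : ↥(unitaryGroupOfForm (galAdicCompletionMap (L := L) (IsCMField.complexConj L) hw) (placeForm (Matrix.of fun i j : Fin 3 => if i.val + j.val + 1 = 3 then (1 : L) else 0) w.1))) : GL (Fin 3) (w.1.adicCompletion L)) : Matrix (Fin 3) (Fin 3) (w.1.adicCompletion L)) - 1)) M)}.ncard : ℂ))) =
            (((νG₃ (cmLocalIntegralLevel L 3 (Matrix.of fun i j : Fin 3 => if i.val + j.val + 1 = 3 then (1 : L) else 0) v : Set ((UnitaryGroup.cmDatum L 3 (Matrix.of fun i j : Fin 3 => if i.val + j.val + 1 = 3 then (1 : L) else 0)).Local v))).toReal : ℂ) * ((2 * (Fintype.card (Valued.ResidueField (w.1.adicCompletion L)) : ℚ) ^ (-(ks : ℤ)) : ℚ) : ℂ)) / 2 * ((Nat.card (MulAction.fixedBy (((UnitaryGroup.cmDatum L 2 (Matrix.of fun i j : Fin 2 => if i.val + j.val + 1 = 2 then (1 : L) else 0)).Local v)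 ⧸ cmLocalIntegralLevel L 2 (Matrix.of fun i j : Fin 2 => if i.val + j.val + 1 = 2 then (1 : L) else 0) v) γH.1) : ℂ) + ((d % 2 : ℕ) : ℂ)) + (((νG₃ (cmLocalIntegralLevel L 3 (Matrix.of fun i j : Fin 3 => if i.val + j.val + 1 = 3 then (1 : L) else 0) v : Set ((UnitaryGroup.cmDatum L 3 (Matrix.of fun i j : Fin 3 => if i.val + j.val + 1 = 3 then (1 : L) else 0)).Local v))).toReal : ℂ) * ((4 * ((Fintype.card (Valued.ResidueField (w.1.adicCompletion L)) : ℚ) ^ (-(ks : ℤ)) -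
                    (Fintype.card (Valued.ResidueField (w.1.adicCompletion L)) : ℚ) ^ (shiftR d tE - ks + bs)) / ((Fintype.card (Valued.ResidueField (w.1.adicCompletion L)) : ℚ) - 1) : ℚ) : ℂ)) / 2 :=
  levels_typeTwo_censusLaw_of_levelsCensus4 L w hw he ϖ d tE νG₃ a b ks bs (d - d % 2 + bs) rfl
    (levelsCensus4_of_levelsCensus2 L w hw ϖ hϖ d a b ks _
      (levelsCensus2_of_types L w hw he ϖ d a b ks _
        (levelsCensusA L w hw he ϖ hϖ d tE hD h2v a b ks _ had hab1 hks (fun h0 => by omega) (fun h1 => by omega))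
        (levelsCensusB L w hw he ϖ hϖ d tE hD h2v a b ks _ had hab1 hks (fun h0 => by omega) (fun h1 => by omega)) hC))

end Summit.HodgeConjecture.HodgeConjecture.Cruxes.H413.F0P3cDyRamLevelsTypeTwoCensusLawOfRecord

end
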